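import Literature.Analysis.FluidPDE.TaoLocalisationFromY6
import Literature.Analysis.FluidPDE.TaoY6WhitneySum
import HarnessLib

/-!
# Tao (2011/2013), Cor. 11.1 + Cor. 4.3 + Thm. 5.4 (iv): discharge of
# `tao2011_hasBoundedSobolevNormsOn`

Discharge file for the named fact `Literature.Analysis.FluidPDE.tao2011_hasBoundedSobolevNormsOn`
(`TaoLocalisation.lean`; T. Tao, *Localisation and compactness properties of the Navier–Stokes
global regularity problem*, Anal. PDE 6 (2013) 25–107 = arXiv:1108.1165, Cor. 11.1 with Cor. 4.3
and Thm. 5.4 (iv): a finite energy classical solution of the unforced Navier–Stokes system on a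
closed slab `[0, T] × ℝ³` whose datum has rapidly decaying derivatives has all spatial `L²` Sobolev
norms bounded on `[0, T]`).

The tree reduces the fact to Tao's nonlinear estimate for the term `Y₆` of the proof of Thm. 10.1
(`tao2011_hasBoundedSobolevNormsOn_of_nonlinearEstimate`, `TaoLocalisationFromY6.lean`: Lemma 8.1,
Prop. 9.1, Thm. 10.1/Remark 10.6 in a priori form, the Fourier step of Cor. 11.1 and the
persistence of regularity are theorems of the tree), and the nonlinear estimate is itself a
theorem (`tao2011_nonlinearEstimate_holds`, `TaoY6WhitneySum.lean`: Whitney decomposition, local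
Biot–Savart law, Sobolev/Poincaré on balls, parent-ball chaining, (10.19)–(10.24)). Composing:

* `tao2011_hasBoundedSobolevNormsOn_holds : tao2011_hasBoundedSobolevNormsOn`.

A separate file (rather than an append to `TaoLocalisation.lean` / `TaoLocalisationProofs.lean`)
because the `Y₆` files import `TaoLocalisation.lean` transitively and `TaoLocalisationProofs.lean`
is imported by files upstream of the §10 development.

## References

* T. Tao, arXiv:1108.1165 (`Tao2011`): Cor. 11.1 (p. 36), Cor. 4.3, Thm. 5.4 (iv), Lemma 8.1,
  Prop. 9.1, Thm. 10.1 + Remark 10.6 and its proof (§10, pp. 30–33).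
-/

noncomputable section

namespace Literature.Analysis.FluidPDE

/-- **Tao 2011, Cor. 11.1 (with Cor. 4.3 and Thm. 5.4 (iv)) — a theorem**: a finite energy
classical solution `(u, p)` of the unforced Navier–Stokes system (viscosity `ν > 0`) on
`[0, T] × ℝ³` with `sup_{t ∈ [0,T]} ‖u(t)‖_{L²} < ∞` and datum `u(0)` with rapidly decaying
derivatives of all orders has `sup_{t ∈ [0,T]} ‖∇ⁿu(t)‖_{L²} < ∞` for every `n`
(discharge of the named fact `tao2011_hasBoundedSobolevNormsOn`). [cite: Tao2011, Cor. 11.1 + Cor. 4.3 + Thm. 5.4 (iv); proof via Lemma 8.1, Prop. 9.1, Thm. 10.1/Remark 10.6] -/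
theorem tao2011_hasBoundedSobolevNormsOn_holds : tao2011_hasBoundedSobolevNormsOn :=
  tao2011_hasBoundedSobolevNormsOn_of_nonlinearEstimate tao2011_nonlinearEstimate_holds

end Literature.Analysis.FluidPDE

end
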